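import Literature.AlgebraicGeometry.HodgeTheory.DiagonalTorusMonodromy
import Literature.AlgebraicGeometry.HodgeTheory.PencilCircleHomotopy
import Literature.AlgebraicGeometry.HodgeTheory.UniversalHypersurfaceMonodromyIsometry
import Literature.AlgebraicGeometry.Motives.UniversalHypersurfaceBaseChart
import HarnessLib

/-!
# Transport along a diagonally twisted loop of the universal family is conjugate by the diagonal automorphism

Family `hodge`, layer `Literature/AlgebraicGeometry/HodgeTheory`; theorems only (no definition, no named fact). Written by the
prover seat `hodge-nonav-prover-Bx` (g15, cell `hodge-nonav`) as brick (P4-T) of the programme PL2-MERIDIANS of the seat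
`hodge-nonav-20241-p1` (g18) for crux K1-B `VeryGeneralSignCommutatorsInHg` (stmt-HodgeConjecture-19716): the reduction of the
exchanged-pair Picard–Lefschetz binder `picardLefschetz_exchangedPair` to the one-node binder needs to know how the monodromy of the
universal family of smooth degree-`d` hypersurfaces `π : 𝒴_U → U` transforms when a loop is TWISTED by a diagonal matrix `a`.

Let `s ∈ U(ℂ)` be a point whose form `F_s` is `a`-invariant (`a ∈ diagonalStabilizer F_s`), and let `ℓ, ℓ'` be loops at `s` with
`F_{ℓ'(u)} = F_{ℓ(u)}(a • x)` for all `u` (the loop `ℓ'` is the image of `ℓ` under the coefficient action of `a`, which fixes `s`).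
The continuous square `(r, u) ↦ [F_{ℓ(u)}(b_{1-r} • x)]`, `b_r = exp(r·log a)` the one-parameter subgroup from `1` to `a`
(`DiagonalTorus.expPath`), has horizontal edges `ℓ'` (`r = 0`), `ℓ` (`r = 1`) and both vertical edges the REVERSED TORUS LOOP
`τ⁻¹` at `s` (`τ(r) = [F_s(b_r • x)]`, 19716-p2's `DiagonalTorus.exists_loop_isRatTransport_autPull`), so `[ℓ'] = [τ]⁻¹·[ℓ]·[τ]` in
`π₁(U(ℂ), s)` (Hatcher 1.19, the tree's `MeridianConj.mk_eq_conj_of_square`); since the rational transport along `τ` is the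
diagonal automorphism `S = e^* g_a^* (e^*)⁻¹` of `Hᵏ(Y_s(ℂ); ℚ)` (Katz's torus trick, `DiagonalTorusMonodromy`), the transport along
`ℓ'` is `S⁻¹ ≫ T ≫ S` for `T` the transport along `ℓ` (`PencilCircleHomotopy.isRatTransport_conj_of_loopClassUniv_eq`).

* `exists_continuousMap_pointForm_twist` — continuous families of diagonally twisted forms lift to `U(ℂ)`;
* `loopClassUniv_twistedLoop_eq_conj` — `[ℓ'] = [τ⁻¹]·[ℓ]·[τ⁻¹]⁻¹`;
* **`isRatTransport_twistedLoop`** — transport along `ℓ'` `= S.symm ≪≫ T ≪≫ S`;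
* **`exists_fiberIso_isRatTransport_twistedLoop`** — the same with `S` read as `(pullEquiv σ')⁻¹` for an automorphism `σ'` of the
  fibre `Y_s` acting as `[z] ↦ [a • z]` on homogeneous coordinates (the shape quantified in `picardLefschetz_exchangedPair`).

Appendix (g16, asked by `hodge-nonav-20241-p1` for the core `exists_isPicardLefschetzData_two_of_meridian`, whose conjugating
operator must be an ISOMETRY of the middle intersection form `B_s = tr_s ∘ ∪`): the conjugating operators are MONODROMIES of the
universal family (the torus loop, `DiagonalTorusMonodromy`), and monodromies are isometries (Beauville 1986 §2, the tree's
`UniversalHypersurfaceMonodromyIsometry.tr_cup_eq_of_mem_ratMonodromyGroup`):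

* `torusMonodromy_mem_ratMonodromyGroup`, `tr_cup_torusMonodromy`, `tr_cup_torusMonodromy_symm` — `S ∈ Γ_s`, and `S`, `S⁻¹`
  preserve `B_s`;
* `isRatTransport_twistedLoop_refl` — in a degree where the transport along `ℓ` is the identity, so is the transport along `ℓ'`;
* **`exists_fiberIso_isRatTransport_twistedLoop_isometry`** — ONE `σ'` for all degrees `k`, with `(pullEquiv σ' k) ∈ Γ_s`, the
  isometry of `pullEquiv σ' n` and of its inverse, the conjugation formula and the identity-transport clause.

Honest scope: a statement about loops at an `a`-FIXED base point only (no base-moving equivariance of the family is constructed);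
nothing here says HC or any rung is proved.

## References

* [Katz2009] N. M. Katz, Another look at the Dwork family, Progr. Math. 269 (2009), §3 (the diagonal group acts on the family over
  its parameter space).
* [VoisinHodgeII2003] C. Voisin, Hodge Theory and Complex Algebraic Geometry II, CUP 2003, §3.1.2 (monodromy representation),
  §6.2.1.
* [Hatcher2002] A. Hatcher, Algebraic Topology, CUP 2002, §1.1 Lemma 1.19 (free homotopies conjugate).
* [Beauville1986Monodromie] A. Beauville, Le groupe de monodromie des familles universelles d'hypersurfaces et d'intersections
  complètes, LNM 1194 (1986), §2 (p. 11: the monodromy group preserves the intersection form).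
-/

noncomputable section

namespace Literature.AlgebraicGeometry.HodgeTheory

open CategoryTheory _root_.AlgebraicGeometry MvPolynomial
open _root_.Topology
open scoped unitInterval
open Literature.AlgebraicGeometry.Motives Literature.AlgebraicGeometry.Motives.UniversalHypersurface
open Literature.AlgebraicGeometry.HodgeTheory.UniversalHypersurface
open Literature.AlgebraicTopology.SingularHomology
open Literature.NumberTheory.Transcendental
open Literature.AlgebraicGeometry.FundamentalGroup
open scoped LinearAlgebra.Projectivization

namespace DiagonalTorus

variable {n d : ℕ}

/-! ### Continuous families of twisted forms -/

/-- **Continuous families of diagonally twisted forms lift to `U(ℂ)`** (`d ≥ 1`): for a continuous map `Ψ : X → U(ℂ)` and a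
continuous family of diagonal matrices `b : X → (ℂˣ)ⁿ⁺²`, `x ↦ [F_{Ψ x}(b(x) • ·)]` is a continuous map `X → U(ℂ)` (the twisted
forms are nonsingular, `isNonsingularForm_twist`; lift through the coefficient chart, `continuous_pointOfCoeffs_comp`).
[cite: VoisinHodgeII2003, §6.2.1] [cite: Katz2009, §3] -/
theorem exists_continuousMap_pointForm_twist {X : Type*} [TopologicalSpace X] (b : X → Fin (n + 2) → ℂˣ)
    (hb : Continuous fun x => fun i => ((b x i : ℂˣ) : ℂ)) (Ψ : C(X, ComplexPoints (base ℂ n d))) :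
    ∃ Φ : C(X, ComplexPoints (base ℂ n d)),
      ∀ x, pointForm ℂ n d (Φ x) = aeval (diagonalSubst (b x)) (pointForm ℂ n d (Ψ x)) := by
  classical
  -- the coefficient vectors of the twisted forms
  let c : X → DegIndex n d → ℂ := fun x m => (∏ i, ((b x i : ℂˣ) : ℂ) ^ m.1 i) * coeffVector ℂ n d (Ψ x) m
  have hform : ∀ x, formOfCoeffs (c x) = aeval (diagonalSubst (b x)) (pointForm ℂ n d (Ψ x)) := fun x => by
    have h1 : c x = fun m : DegIndex n d => coeff m.1 (aeval (diagonalSubst (b x)) (pointForm ℂ n d (Ψ x))) :=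
      funext fun m => by simp only [c, coeff_aeval_diagonalSubst, coeffVector_apply]
    rw [h1, formOfCoeffs_coeff]
    exact isHomogeneous_twist d (isHomogeneous_pointForm ℂ n d _) _
  have hJ : ∀ x, SmoothHypersurface.IsNonsingularForm ℂ (formOfCoeffs (c x)) := fun x => by
    rw [hform]; exact isNonsingularForm_twist (isNonsingularForm_pointForm ℂ n d _) _
  have hc : Continuous c := by
    refine continuous_pi fun m => ?_
    refine (continuous_finsetProd _ fun i _ => ((continuous_apply i).comp hb).pow _).mul ?_
    exact (continuous_apply m).comp ((isEmbedding_coeffVector ℂ n d).continuous.comp Ψ.continuous)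
  refine ⟨⟨fun x => pointOfCoeffs ℂ n d (c x) (hJ x), continuous_pointOfCoeffs_comp ℂ n d hc hJ⟩, fun x => ?_⟩
  change pointForm ℂ n d (pointOfCoeffs ℂ n d (c x) (hJ x)) = _
  rw [pointForm_pointOfCoeffs, hform]

/-! ### The twisted loop is conjugate to the loop by the torus loop -/

section TwistedLoop

variable (hn : 1 ≤ n) (hd : 1 ≤ d) (k : ℕ) (hU : IsCohomologicallyLocallyTrivialOn (family ℂ n d) Set.univ)
  (s : ComplexPoints (base ℂ n d)) {a : Fin (n + 2) → ℂˣ} (ha : a ∈ diagonalStabilizer (pointForm ℂ n d s))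
  (e : fiberOver (family ℂ n d) s ≅ SmoothHypersurface.hypersurface (pointForm ℂ n d s))
  (he : e.hom ≫ SmoothHypersurface.hypersurfaceι (pointForm ℂ n d s) =
    fiberι (family ℂ n d) s ≫ UniversalHypersurface.toProjectiveSpace ℂ n d)
  (ℓ ℓ' : Path s s) (hℓ' : ∀ u, pointForm ℂ n d (ℓ' u) = aeval (diagonalSubst a) (pointForm ℂ n d (ℓ u)))
include hℓ'

/-- **`[ℓ'] = [τ⁻¹]·[ℓ]·[τ⁻¹]⁻¹` for the torus loop `τ` at `s`** (any loop `τ` at `s` with forms `F_s(b_r • x)`).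
[cite: Hatcher2002, §1.1 Lemma 1.19] [cite: Katz2009, §3] -/
theorem loopClassUniv_twistedLoop_eq_conj
    (τ : Path (⟨s, Set.mem_univ s⟩ : (Set.univ : Set (ComplexPoints (base ℂ n d)))) ⟨s, Set.mem_univ s⟩)
    (hτ : ∀ r, pointForm ℂ n d (τ r).1 = aeval (diagonalSubst (expPath a r)) (pointForm ℂ n d s)) :
    loopClassUniv n d ℓ' =
      (Path.Homotopic.Quotient.mk τ.symm).trans ((loopClassUniv n d ℓ).trans (Path.Homotopic.Quotient.mk τ.symm).symm) := by
  -- the square `(r, u) ↦ [F_{ℓ u}(b_{1-r} • x)]`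
  let b : I × I → Fin (n + 2) → ℂˣ := fun ru => expPath a ((unitInterval.symm ru.1 : I) : ℝ)
  have hb : Continuous fun ru : I × I => fun i => ((b ru i : ℂˣ) : ℂ) :=
    (continuous_expPath_val a).comp (continuous_induced_dom.comp (unitInterval.continuous_symm.comp continuous_fst))
  let Ψ : C(I × I, ComplexPoints (base ℂ n d)) := ⟨fun ru => ℓ ru.2, ℓ.continuous.comp continuous_snd⟩
  obtain ⟨Φ, hΦ⟩ := exists_continuousMap_pointForm_twist b hb Ψ
  -- edges
  have h0 : ∀ u, Φ (0, u) = ℓ' u := fun u => by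
    apply pointForm_injective ℂ n d
    rw [hΦ, hℓ']
    change aeval (diagonalSubst (expPath a ((unitInterval.symm (0 : I) : I) : ℝ))) (pointForm ℂ n d (ℓ u)) = _
    rw [unitInterval.symm_zero, Set.Icc.coe_one, expPath_one]
  have h1 : ∀ u, Φ (1, u) = ℓ u := fun u => by
    apply pointForm_injective ℂ n d
    rw [hΦ]
    change aeval (diagonalSubst (expPath a ((unitInterval.symm (1 : I) : I) : ℝ))) (pointForm ℂ n d (ℓ u)) = _
    rw [unitInterval.symm_one, Set.Icc.coe_zero, expPath_zero, aeval_diagonalSubst_one]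
  have hside : ∀ r, Φ (r, 0) = (τ.symm r).1 ∧ Φ (r, 1) = (τ.symm r).1 := fun r => by
    have hτ' : pointForm ℂ n d (τ.symm r).1 = aeval (diagonalSubst (b (r, 0))) (pointForm ℂ n d s) := by
      rw [Path.symm_apply, Function.comp_apply, hτ]
    constructor
    · apply pointForm_injective ℂ n d
      rw [hΦ, hτ']
      change aeval (diagonalSubst (b (r, 0))) (pointForm ℂ n d (ℓ 0)) = _
      rw [ℓ.source]
    · apply pointForm_injective ℂ n d
      rw [hΦ, hτ']
      change aeval (diagonalSubst (b (r, 1))) (pointForm ℂ n d (ℓ 1)) = _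
      rw [ℓ.target]
  -- Hatcher 1.19 in `Set.univ ⊆ U(ℂ)`
  have hsq := MeridianConj.mk_eq_conj_of_square ((toUniv n d).comp Φ) (ℓ'.map (toUniv n d).continuous)
    (ℓ.map (toUniv n d).continuous) τ.symm
    (fun u => Subtype.ext (by change Φ (0, u) = ℓ' u; exact h0 u))
    (fun u => Subtype.ext (by change Φ (1, u) = ℓ u; exact h1 u))
    (fun r => Subtype.ext (by change Φ (r, 0) = (τ.symm r).1; exact (hside r).1))
    (fun r => Subtype.ext (by change Φ (r, 1) = (τ.symm r).1; exact (hside r).2))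
  exact hsq

include hn hd he in
/-- **Transport along the twisted loop `ℓ'` is `S⁻¹ ≫ T ≫ S`**, `T` the transport along `ℓ` and
`S = e^* g_a^* (e^*)⁻¹` the torus monodromy at `s` (`n, d ≥ 1`). [cite: Katz2009, §3] [cite: VoisinHodgeII2003, §3.1.2]
[cite: Hatcher2002, §1.1 Lemma 1.19] -/
theorem isRatTransport_twistedLoop
    {T : bettiCohomology (fiberOver (family ℂ n d) s) k ≃ₗ[ℚ] bettiCohomology (fiberOver (family ℂ n d) s) k}
    (hT : IsRatTransport (family ℂ n d) k hU (loopClassUniv n d ℓ) T) :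
    IsRatTransport (family ℂ n d) k hU (loopClassUniv n d ℓ')
      ((BettiUniverse.pullEquiv e k ≪≫ₗ autPull (pointForm ℂ n d s) ha k ≪≫ₗ (BettiUniverse.pullEquiv e k).symm).symm ≪≫ₗ
        (T ≪≫ₗ (BettiUniverse.pullEquiv e k ≪≫ₗ autPull (pointForm ℂ n d s) ha k ≪≫ₗ (BettiUniverse.pullEquiv e k).symm))) := by
  -- the torus loop at `s` and its transport
  obtain ⟨τ, hτ, hτT⟩ := exists_loop_isRatTransport_autPull (isHomogeneous_pointForm ℂ n d s) (isNonsingularForm_pointForm ℂ n d s)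
    hn hd ha k s (pointOfForm_pointForm ℂ n d s).symm e he
  -- all cohomological trivialisation data agree (a `Prop`)
  have hUeq : hU = isCohomologicallyLocallyTrivialOn_family n d hd := rfl
  subst hUeq
  have hconj := loopClassUniv_twistedLoop_eq_conj s ℓ ℓ' hℓ' τ hτ
  have hK : IsRatTransport (family ℂ n d) k (isCohomologicallyLocallyTrivialOn_family n d hd) (Path.Homotopic.Quotient.mk τ.symm)
      (BettiUniverse.pullEquiv e k ≪≫ₗ autPull (pointForm ℂ n d s) ha k ≪≫ₗ (BettiUniverse.pullEquiv e k).symm).symm := by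
    rw [Path.Homotopic.Quotient.mk_symm]
    exact hτT.symm (family ℂ n d) k _
  have h := isRatTransport_conj_of_loopClassUniv_eq (isCohomologicallyLocallyTrivialOn_family n d hd) hconj hK hT
  rw [LinearEquiv.symm_symm] at h
  exact h

end TwistedLoop

/-! ### The same with the diagonal automorphism of the fibre -/

/-- **The diagonal automorphism of an `a`-invariant fibre and the transport along twisted loops.** For `s ∈ U(ℂ)` with
`a ∈ diagonalStabilizer F_s` (`n, d ≥ 1`) there is an automorphism `σ'` of the fibre `Y_s` over `ℂ` acting as `[z] ↦ [a • z]` on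
homogeneous coordinates such that, for every pair of loops `ℓ, ℓ'` at `s` with `F_{ℓ'(u)} = F_{ℓ(u)}(a • x)` and every rational
transport `T` along `ℓ`, the rational transport along `ℓ'` is `pullEquiv σ' ≪≫ (T ≪≫ (pullEquiv σ')⁻¹)`.
[cite: Katz2009, §3] [cite: VoisinHodgeII2003, §3.1.2] [cite: Hatcher2002, §1.1 Lemma 1.19] -/
theorem exists_fiberIso_isRatTransport_twistedLoop (hn : 1 ≤ n) (hd : 1 ≤ d) (k : ℕ)
    (hU : IsCohomologicallyLocallyTrivialOn (family ℂ n d) Set.univ) (s : ComplexPoints (base ℂ n d)) {a : Fin (n + 2) → ℂˣ}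
    (ha : a ∈ diagonalStabilizer (pointForm ℂ n d s)) :
    ∃ σ' : fiberOver (family ℂ n d) s ≅ fiberOver (family ℂ n d) s,
      (∀ x : ComplexPoints (fiberOver (family ℂ n d) s),
        fibrePoint n d s (AlgPoints.map σ'.hom x) =
          Projectivization.mk ℂ (a • (fibrePoint n d s x).rep) ((smul_ne_zero_iff_ne a).mpr (Projectivization.rep_nonzero _))) ∧
      ∀ (ℓ ℓ' : Path s s), (∀ u, pointForm ℂ n d (ℓ' u) = aeval (diagonalSubst a) (pointForm ℂ n d (ℓ u))) →
        ∀ {T : bettiCohomology (fiberOver (family ℂ n d) s) k ≃ₗ[ℚ] bettiCohomology (fiberOver (family ℂ n d) s) k},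
          IsRatTransport (family ℂ n d) k hU (loopClassUniv n d ℓ) T →
          IsRatTransport (family ℂ n d) k hU (loopClassUniv n d ℓ')
            (BettiUniverse.pullEquiv σ' k ≪≫ₗ (T ≪≫ₗ (BettiUniverse.pullEquiv σ' k).symm)) := by
  obtain ⟨e, he⟩ := exists_fiberIso_comp_hypersurfaceι ℂ n d hd s
  -- the diagonal automorphism `g_a` of `X_F` as an isomorphism, transported to the fibre: `σ' = e ≫ g_a ≫ e⁻¹`
  let gI : SmoothHypersurface.hypersurface (pointForm ℂ n d s) ≅ SmoothHypersurface.hypersurface (pointForm ℂ n d s) :=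
    ⟨diagonalAut (pointForm ℂ n d s) ha, diagonalAut (pointForm ℂ n d s) (inv_mem ha),
      diagonalAut_comp_inv_over (pointForm ℂ n d s) ha, diagonalAut_inv_comp_over (pointForm ℂ n d s) ha⟩
  obtain ⟨σ', hσ₁, hσ₂⟩ : ∃ σ' : fiberOver (family ℂ n d) s ≅ fiberOver (family ℂ n d) s,
      σ'.hom = e.hom ≫ (diagonalAut (pointForm ℂ n d s) ha ≫ e.inv) ∧
        σ'.inv = (e.hom ≫ diagonalAut (pointForm ℂ n d s) (inv_mem ha)) ≫ e.inv :=
    ⟨e ≪≫ (gI ≪≫ e.symm), rfl, rfl⟩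
  refine ⟨σ', fun x => ?_, fun ℓ ℓ' hℓ' T hT => ?_⟩
  · -- coordinates: `fibrePoint s = hypersurfacePoint ι ∘ e`, and `g_a` acts as `a • ·`
    have hfp : ∀ y : ComplexPoints (fiberOver (family ℂ n d) s),
        fibrePoint n d s y = hypersurfacePoint (SmoothHypersurface.hypersurfaceι (pointForm ℂ n d s)) (AlgPoints.map e.hom y) :=
        fun y => by
      rw [fibrePoint_def, ← he, hypersurfacePoint_comp]
    have hmap : AlgPoints.map e.hom (AlgPoints.map σ'.hom x) =
        AlgPoints.map (diagonalAut (pointForm ℂ n d s) ha) (AlgPoints.map e.hom x) := by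
      rw [hσ₁, ← AlgPoints.map_comp_apply, Category.assoc, Category.assoc, Iso.inv_hom_id, Category.comp_id,
        AlgPoints.map_comp_apply]
    rw [hfp, hmap, ← diagonalMap_apply, hypersurfacePoint_diagonalMap]
    congr 1
    rw [hfp]
  · -- the torus loop `τ` at `s` with transport `S = (e⁻¹)^* g_a^* e^*`, and `[ℓ'] = [τ⁻¹]·[ℓ]·[τ⁻¹]⁻¹` (Hatcher 1.19)
    obtain ⟨τ, hτ, hτT⟩ := exists_loop_isRatTransport_autPull (isHomogeneous_pointForm ℂ n d s)
      (isNonsingularForm_pointForm ℂ n d s) hn hd ha k s (pointOfForm_pointForm ℂ n d s).symm e he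
    have hτT' : IsRatTransport (family ℂ n d) k hU (Path.Homotopic.Quotient.mk τ)
        (BettiUniverse.pullEquiv e k ≪≫ₗ autPull (pointForm ℂ n d s) ha k ≪≫ₗ (BettiUniverse.pullEquiv e k).symm) := hτT
    have hconj := loopClassUniv_twistedLoop_eq_conj s ℓ ℓ' hℓ' τ hτ
    -- `S⁻¹ = pullEquiv σ'` pointwise
    have hPv : ∀ v, BettiUniverse.pullEquiv σ' k v = (BettiUniverse.pullEquiv e k).symm
        ((autPull (pointForm ℂ n d s) ha k).symm (BettiUniverse.pullEquiv e k v)) := fun v => by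
      rw [BettiUniverse.pullEquiv_apply σ' k v, hσ₂]
      change _ = BettiUniverse.pull e.hom k (BettiUniverse.pull (diagonalAut (pointForm ℂ n d s) (inv_mem ha)) k
        (BettiUniverse.pull e.inv k v))
      rw [pull_pull, pull_pull]
    have hKv : ∀ v, (BettiUniverse.pullEquiv e k ≪≫ₗ autPull (pointForm ℂ n d s) ha k ≪≫ₗ
        (BettiUniverse.pullEquiv e k).symm).symm v = BettiUniverse.pullEquiv σ' k v := fun v => by
      rw [LinearEquiv.symm_apply_eq, hPv]
      simp only [LinearEquiv.trans_apply, LinearEquiv.apply_symm_apply, LinearEquiv.symm_apply_apply]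
    have hK : IsRatTransport (family ℂ n d) k hU (Path.Homotopic.Quotient.mk τ.symm) (BettiUniverse.pullEquiv σ' k) := by
      rw [Path.Homotopic.Quotient.mk_symm]
      exact fun v => ((congrArg (ofRatClass _ k) (hKv v)).symm.trans ((hτT'.symm (family ℂ n d) k hU) v))
    exact isRatTransport_conj_of_loopClassUniv_eq hU hconj hK hT

/-! ### Appendix: the conjugating operators are monodromies, hence isometries of the intersection form -/

section Isometry

variable (hn : 1 ≤ n) (hd : 1 ≤ d) (hU : IsCohomologicallyLocallyTrivialOn (family ℂ n d) Set.univ)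
  (s : ComplexPoints (base ℂ n d)) {a : Fin (n + 2) → ℂˣ} (ha : a ∈ diagonalStabilizer (pointForm ℂ n d s))
  (e : fiberOver (family ℂ n d) s ≅ SmoothHypersurface.hypersurface (pointForm ℂ n d s))
  (he : e.hom ≫ SmoothHypersurface.hypersurfaceι (pointForm ℂ n d s) =
    fiberι (family ℂ n d) s ≫ UniversalHypersurface.toProjectiveSpace ℂ n d)
include hn hd hU ha he

/-- **The torus monodromy `S = e^* g_a^* (e^*)⁻¹` at an `a`-fixed point `s ∈ U(ℂ)` is a monodromy transformation**:
`S ∈ Γ_s`, the monodromy group of `Rᵏ π_* ℚ` of the universal family at `s` (any degree `k`, any cohomological local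
trivialisation datum `hU` — a `Prop`), because it is the rational transport along the torus loop at `s`
(`exists_loop_isRatTransport_autPull`). [cite: Katz2009, §3] [cite: VoisinHodgeII2003, §3.1.2] -/
theorem torusMonodromy_mem_ratMonodromyGroup (k : ℕ) :
    BettiUniverse.pullEquiv e k ≪≫ₗ autPull (pointForm ℂ n d s) ha k ≪≫ₗ (BettiUniverse.pullEquiv e k).symm ∈
      ratMonodromyGroup (family ℂ n d) k hU (toUniv n d s) := by
  obtain ⟨τ, -, hτT⟩ := exists_loop_isRatTransport_autPull (isHomogeneous_pointForm ℂ n d s)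
    (isNonsingularForm_pointForm ℂ n d s) hn hd ha k s (pointOfForm_pointForm ℂ n d s).symm e he
  have hτT' : IsRatTransport (family ℂ n d) k hU (Path.Homotopic.Quotient.mk τ)
      (BettiUniverse.pullEquiv e k ≪≫ₗ autPull (pointForm ℂ n d s) ha k ≪≫ₗ (BettiUniverse.pullEquiv e k).symm) := hτT
  exact mem_ratMonodromyGroup_of_isRatTransport _ _ _ hτT'

/-- The INVERSE torus monodromy `S⁻¹ = e^* g_{a⁻¹}^* (e^*)⁻¹` is a monodromy transformation as well (transport along the
reversed torus loop). [cite: Katz2009, §3] [cite: VoisinHodgeII2003, §3.1.2] -/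
theorem torusMonodromy_symm_mem_ratMonodromyGroup (k : ℕ) :
    (BettiUniverse.pullEquiv e k ≪≫ₗ autPull (pointForm ℂ n d s) ha k ≪≫ₗ (BettiUniverse.pullEquiv e k).symm).symm ∈
      ratMonodromyGroup (family ℂ n d) k hU (toUniv n d s) := by
  obtain ⟨τ, -, hτT⟩ := exists_loop_isRatTransport_autPull (isHomogeneous_pointForm ℂ n d s)
    (isNonsingularForm_pointForm ℂ n d s) hn hd ha k s (pointOfForm_pointForm ℂ n d s).symm e he
  have hτT' : IsRatTransport (family ℂ n d) k hU (Path.Homotopic.Quotient.mk τ)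
      (BettiUniverse.pullEquiv e k ≪≫ₗ autPull (pointForm ℂ n d s) ha k ≪≫ₗ (BettiUniverse.pullEquiv e k).symm) := hτT
  exact mem_ratMonodromyGroup_of_isRatTransport _ _ _ (hτT'.symm (family ℂ n d) k hU)

/-- **The torus monodromy is an isometry of the intersection form** `B_s(x, y) = tr_s(x ∪ y)` on `Hⁿ(Y_s(ℂ); ℚ)`:
monodromy transformations of the universal family preserve `B_s` (Beauville: "il est clair que `Γ ⊂ O_h`"; the tree's
`tr_cup_eq_of_mem_ratMonodromyGroup`). [cite: Beauville1986Monodromie, §2 (p. 11)] [cite: VoisinHodgeII2003, §3.2.3] -/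
theorem tr_cup_torusMonodromy (x y : bettiCohomology (fiberOver (family ℂ n d) s) n) :
    BettiUniverse.tr ((isSmoothProjectiveFamily_family ℂ hn hd).isSmoothProjective s) (n + n)
        (BettiUniverse.cup (fiberOver (family ℂ n d) s) n n
          ((BettiUniverse.pullEquiv e n ≪≫ₗ autPull (pointForm ℂ n d s) ha n ≪≫ₗ (BettiUniverse.pullEquiv e n).symm) x)
          ((BettiUniverse.pullEquiv e n ≪≫ₗ autPull (pointForm ℂ n d s) ha n ≪≫ₗ (BettiUniverse.pullEquiv e n).symm) y)) =
      BettiUniverse.tr ((isSmoothProjectiveFamily_family ℂ hn hd).isSmoothProjective s) (n + n)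
        (BettiUniverse.cup (fiberOver (family ℂ n d) s) n n x y) := by
  haveI := BettiUniverse.finite ((isSmoothProjectiveFamily_family ℂ hn hd).isSmoothProjective s) n
  exact tr_cup_eq_of_mem_ratMonodromyGroup hU hn hd (torusMonodromy_mem_ratMonodromyGroup hn hd hU s ha e he n) x y

/-- The INVERSE torus monodromy `S⁻¹` is an isometry of `B_s` as well (`Γ_s` is a group).
[cite: Beauville1986Monodromie, §2 (p. 11)] [cite: VoisinHodgeII2003, §3.2.3] -/
theorem tr_cup_torusMonodromy_symm (x y : bettiCohomology (fiberOver (family ℂ n d) s) n) :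
    BettiUniverse.tr ((isSmoothProjectiveFamily_family ℂ hn hd).isSmoothProjective s) (n + n)
        (BettiUniverse.cup (fiberOver (family ℂ n d) s) n n
          ((BettiUniverse.pullEquiv e n ≪≫ₗ autPull (pointForm ℂ n d s) ha n ≪≫ₗ (BettiUniverse.pullEquiv e n).symm).symm x)
          ((BettiUniverse.pullEquiv e n ≪≫ₗ autPull (pointForm ℂ n d s) ha n ≪≫ₗ (BettiUniverse.pullEquiv e n).symm).symm y)) =
      BettiUniverse.tr ((isSmoothProjectiveFamily_family ℂ hn hd).isSmoothProjective s) (n + n)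
        (BettiUniverse.cup (fiberOver (family ℂ n d) s) n n x y) := by
  haveI := BettiUniverse.finite ((isSmoothProjectiveFamily_family ℂ hn hd).isSmoothProjective s) n
  exact tr_cup_eq_of_mem_ratMonodromyGroup hU hn hd (torusMonodromy_symm_mem_ratMonodromyGroup hn hd hU s ha e he n) x y

/-- **Identity transports stay identities under twisting**: if the rational transport along `ℓ` in degree `k` is the
identity, so is the transport along the twisted loop `ℓ'` (`F_{ℓ'(u)} = F_{ℓ(u)}(a • x)`), since `S⁻¹ ≫ 𝟙 ≫ S = 𝟙`
(`isRatTransport_twistedLoop`). [cite: Katz2009, §3] [cite: Hatcher2002, §1.1 Lemma 1.19] -/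
theorem isRatTransport_twistedLoop_refl (k : ℕ) (ℓ ℓ' : Path s s)
    (hℓ' : ∀ u, pointForm ℂ n d (ℓ' u) = aeval (diagonalSubst a) (pointForm ℂ n d (ℓ u)))
    (hT : IsRatTransport (family ℂ n d) k hU (loopClassUniv n d ℓ) (LinearEquiv.refl ℚ _)) :
    IsRatTransport (family ℂ n d) k hU (loopClassUniv n d ℓ') (LinearEquiv.refl ℚ _) := by
  have h := isRatTransport_twistedLoop hn hd k hU s ha e he ℓ ℓ' hℓ' hT
  intro v
  rw [← h v, LinearEquiv.trans_apply, LinearEquiv.trans_apply]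
  exact congrArg _ (LinearEquiv.apply_symm_apply _ v).symm

end Isometry

/-- **The diagonal automorphism of an `a`-invariant fibre, uniformly in the degree, with its isometry.** For `s ∈ U(ℂ)`
with `a ∈ diagonalStabilizer F_s` (`n, d ≥ 1`) there is ONE automorphism `σ'` of the fibre `Y_s` over `ℂ`, acting as
`[z] ↦ [a • z]` on homogeneous coordinates, such that: `(σ')^* ∈ Γ_s` in every degree `k` (a monodromy transformation);
`(σ')^*` and its inverse are isometries of `B_s = tr_s ∘ ∪` on `Hⁿ`; for every degree `k`, every pair of loops `ℓ, ℓ'` at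
`s` with `F_{ℓ'(u)} = F_{ℓ(u)}(a • x)` and every rational transport `T` along `ℓ`, the transport along `ℓ'` is
`(σ')^* ≫ T ≫ ((σ')^*)⁻¹`, and identity transports along `ℓ` give identity transports along `ℓ'`. (The shape consumed by
`exists_isPicardLefschetzData_two_of_meridian` with `R = ((σ')^*)⁻¹`.)
[cite: Katz2009, §3] [cite: Beauville1986Monodromie, §2 (p. 11)] [cite: VoisinHodgeII2003, §3.1.2]
[cite: Hatcher2002, §1.1 Lemma 1.19] -/
theorem exists_fiberIso_isRatTransport_twistedLoop_isometry (hn : 1 ≤ n) (hd : 1 ≤ d)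
    (hU : IsCohomologicallyLocallyTrivialOn (family ℂ n d) Set.univ) (s : ComplexPoints (base ℂ n d)) {a : Fin (n + 2) → ℂˣ}
    (ha : a ∈ diagonalStabilizer (pointForm ℂ n d s)) :
    ∃ σ' : fiberOver (family ℂ n d) s ≅ fiberOver (family ℂ n d) s,
      (∀ x : ComplexPoints (fiberOver (family ℂ n d) s),
        fibrePoint n d s (AlgPoints.map σ'.hom x) =
          Projectivization.mk ℂ (a • (fibrePoint n d s x).rep) ((smul_ne_zero_iff_ne a).mpr (Projectivization.rep_nonzero _))) ∧
      (∀ k, BettiUniverse.pullEquiv σ' k ∈ ratMonodromyGroup (family ℂ n d) k hU (toUniv n d s)) ∧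
      (∀ x y, BettiUniverse.tr ((isSmoothProjectiveFamily_family ℂ hn hd).isSmoothProjective s) (n + n)
          (BettiUniverse.cup (fiberOver (family ℂ n d) s) n n (BettiUniverse.pullEquiv σ' n x) (BettiUniverse.pullEquiv σ' n y)) =
        BettiUniverse.tr ((isSmoothProjectiveFamily_family ℂ hn hd).isSmoothProjective s) (n + n)
          (BettiUniverse.cup (fiberOver (family ℂ n d) s) n n x y)) ∧
      (∀ x y, BettiUniverse.tr ((isSmoothProjectiveFamily_family ℂ hn hd).isSmoothProjective s) (n + n)
          (BettiUniverse.cup (fiberOver (family ℂ n d) s) n n ((BettiUniverse.pullEquiv σ' n).symm x)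
            ((BettiUniverse.pullEquiv σ' n).symm y)) =
        BettiUniverse.tr ((isSmoothProjectiveFamily_family ℂ hn hd).isSmoothProjective s) (n + n)
          (BettiUniverse.cup (fiberOver (family ℂ n d) s) n n x y)) ∧
      ∀ (k : ℕ) (ℓ ℓ' : Path s s), (∀ u, pointForm ℂ n d (ℓ' u) = aeval (diagonalSubst a) (pointForm ℂ n d (ℓ u))) →
        (∀ {T : bettiCohomology (fiberOver (family ℂ n d) s) k ≃ₗ[ℚ] bettiCohomology (fiberOver (family ℂ n d) s) k},
          IsRatTransport (family ℂ n d) k hU (loopClassUniv n d ℓ) T →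
          IsRatTransport (family ℂ n d) k hU (loopClassUniv n d ℓ')
            (BettiUniverse.pullEquiv σ' k ≪≫ₗ (T ≪≫ₗ (BettiUniverse.pullEquiv σ' k).symm))) ∧
        (IsRatTransport (family ℂ n d) k hU (loopClassUniv n d ℓ) (LinearEquiv.refl ℚ _) →
          IsRatTransport (family ℂ n d) k hU (loopClassUniv n d ℓ') (LinearEquiv.refl ℚ _)) := by
  obtain ⟨e, he⟩ := exists_fiberIso_comp_hypersurfaceι ℂ n d hd s
  -- the diagonal automorphism `g_a` of `X_F` as an isomorphism, transported to the fibre: `σ' = e ≫ g_a ≫ e⁻¹`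
  let gI : SmoothHypersurface.hypersurface (pointForm ℂ n d s) ≅ SmoothHypersurface.hypersurface (pointForm ℂ n d s) :=
    ⟨diagonalAut (pointForm ℂ n d s) ha, diagonalAut (pointForm ℂ n d s) (inv_mem ha),
      diagonalAut_comp_inv_over (pointForm ℂ n d s) ha, diagonalAut_inv_comp_over (pointForm ℂ n d s) ha⟩
  obtain ⟨σ', hσ₁, hσ₂⟩ : ∃ σ' : fiberOver (family ℂ n d) s ≅ fiberOver (family ℂ n d) s,
      σ'.hom = e.hom ≫ (diagonalAut (pointForm ℂ n d s) ha ≫ e.inv) ∧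
        σ'.inv = (e.hom ≫ diagonalAut (pointForm ℂ n d s) (inv_mem ha)) ≫ e.inv :=
    ⟨e ≪≫ (gI ≪≫ e.symm), rfl, rfl⟩
  -- `(σ')^* = S⁻¹` for the torus monodromy `S = e^* g_a^* (e^*)⁻¹`, in every degree
  have hPv : ∀ k v, BettiUniverse.pullEquiv σ' k v = (BettiUniverse.pullEquiv e k).symm
      ((autPull (pointForm ℂ n d s) ha k).symm (BettiUniverse.pullEquiv e k v)) := fun k v => by
    rw [BettiUniverse.pullEquiv_apply σ' k v, hσ₂]
    change _ = BettiUniverse.pull e.hom k (BettiUniverse.pull (diagonalAut (pointForm ℂ n d s) (inv_mem ha)) k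
      (BettiUniverse.pull e.inv k v))
    rw [pull_pull, pull_pull]
  have hKv : ∀ k v, (BettiUniverse.pullEquiv e k ≪≫ₗ autPull (pointForm ℂ n d s) ha k ≪≫ₗ
      (BettiUniverse.pullEquiv e k).symm).symm v = BettiUniverse.pullEquiv σ' k v := fun k v => by
    rw [LinearEquiv.symm_apply_eq, hPv]
    simp only [LinearEquiv.trans_apply, LinearEquiv.apply_symm_apply, LinearEquiv.symm_apply_apply]
  have hK : ∀ k, (BettiUniverse.pullEquiv e k ≪≫ₗ autPull (pointForm ℂ n d s) ha k ≪≫ₗ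
      (BettiUniverse.pullEquiv e k).symm).symm = BettiUniverse.pullEquiv σ' k := fun k => LinearEquiv.ext (hKv k)
  have hK' : ∀ k, (BettiUniverse.pullEquiv σ' k).symm = BettiUniverse.pullEquiv e k ≪≫ₗ autPull (pointForm ℂ n d s) ha k ≪≫ₗ
      (BettiUniverse.pullEquiv e k).symm := fun k => by
    rw [← hK k, LinearEquiv.symm_symm]
  -- `(σ')^*` and its inverse are monodromy transformations
  have hmem : ∀ k, BettiUniverse.pullEquiv σ' k ∈ ratMonodromyGroup (family ℂ n d) k hU (toUniv n d s) := fun k => by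
    rw [← hK k]
    exact torusMonodromy_symm_mem_ratMonodromyGroup hn hd hU s ha e he k
  have hmem' : ∀ k, (BettiUniverse.pullEquiv σ' k).symm ∈ ratMonodromyGroup (family ℂ n d) k hU (toUniv n d s) := fun k => by
    rw [hK' k]
    exact torusMonodromy_mem_ratMonodromyGroup hn hd hU s ha e he k
  -- the conjugation formula, in every degree (as in `exists_fiberIso_isRatTransport_twistedLoop`)
  have htrans : ∀ (k : ℕ) (ℓ ℓ' : Path s s), (∀ u, pointForm ℂ n d (ℓ' u) = aeval (diagonalSubst a) (pointForm ℂ n d (ℓ u))) →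
      ∀ {T : bettiCohomology (fiberOver (family ℂ n d) s) k ≃ₗ[ℚ] bettiCohomology (fiberOver (family ℂ n d) s) k},
        IsRatTransport (family ℂ n d) k hU (loopClassUniv n d ℓ) T →
        IsRatTransport (family ℂ n d) k hU (loopClassUniv n d ℓ')
          (BettiUniverse.pullEquiv σ' k ≪≫ₗ (T ≪≫ₗ (BettiUniverse.pullEquiv σ' k).symm)) := fun k ℓ ℓ' hℓ' T hT => by
    obtain ⟨τ, hτ, hτT⟩ := exists_loop_isRatTransport_autPull (isHomogeneous_pointForm ℂ n d s)
      (isNonsingularForm_pointForm ℂ n d s) hn hd ha k s (pointOfForm_pointForm ℂ n d s).symm e he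
    have hτT' : IsRatTransport (family ℂ n d) k hU (Path.Homotopic.Quotient.mk τ)
        (BettiUniverse.pullEquiv e k ≪≫ₗ autPull (pointForm ℂ n d s) ha k ≪≫ₗ (BettiUniverse.pullEquiv e k).symm) := hτT
    have hconj := loopClassUniv_twistedLoop_eq_conj s ℓ ℓ' hℓ' τ hτ
    have hKτ : IsRatTransport (family ℂ n d) k hU (Path.Homotopic.Quotient.mk τ.symm) (BettiUniverse.pullEquiv σ' k) := by
      rw [Path.Homotopic.Quotient.mk_symm]
      exact fun v => ((congrArg (ofRatClass _ k) (hKv k v)).symm.trans ((hτT'.symm (family ℂ n d) k hU) v))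
    exact isRatTransport_conj_of_loopClassUniv_eq hU hconj hKτ hT
  haveI := BettiUniverse.finite ((isSmoothProjectiveFamily_family ℂ hn hd).isSmoothProjective s) n
  refine ⟨σ', fun x => ?_, hmem, fun x y => tr_cup_eq_of_mem_ratMonodromyGroup hU hn hd (hmem n) x y,
    fun x y => tr_cup_eq_of_mem_ratMonodromyGroup hU hn hd (hmem' n) x y, fun k ℓ ℓ' hℓ' => ⟨htrans k ℓ ℓ' hℓ', fun hT => ?_⟩⟩
  · -- coordinates: `fibrePoint s = hypersurfacePoint ι ∘ e`, and `g_a` acts as `a • ·`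
    have hfp : ∀ y : ComplexPoints (fiberOver (family ℂ n d) s),
        fibrePoint n d s y = hypersurfacePoint (SmoothHypersurface.hypersurfaceι (pointForm ℂ n d s)) (AlgPoints.map e.hom y) :=
        fun y => by
      rw [fibrePoint_def, ← he, hypersurfacePoint_comp]
    have hmap : AlgPoints.map e.hom (AlgPoints.map σ'.hom x) =
        AlgPoints.map (diagonalAut (pointForm ℂ n d s) ha) (AlgPoints.map e.hom x) := by
      rw [hσ₁, ← AlgPoints.map_comp_apply, Category.assoc, Category.assoc, Iso.inv_hom_id, Category.comp_id,
        AlgPoints.map_comp_apply]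
    rw [hfp, hmap, ← diagonalMap_apply, hypersurfacePoint_diagonalMap]
    congr 1
    rw [hfp]
  · -- identity transports
    have h := htrans k ℓ ℓ' hℓ' hT
    intro v
    rw [← h v, LinearEquiv.trans_apply, LinearEquiv.trans_apply]
    exact congrArg _ (LinearEquiv.symm_apply_apply _ v).symm

end DiagonalTorus

end Literature.AlgebraicGeometry.HodgeTheory

end
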